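import Summits.MatrixMultiplication.MatrixMultiplication.Theses.CartanCubic
import Literature.Barriers.MatrixMultiplication.UniversalMethodBarrierDegenerationPow

/-!
# Crux `E6ThreeProducts` (stmt-MatrixMultiplication-8157) — `Lines/birth.lean`, the BC3 birth skeleton

Route `CartanCubic` (route-MatrixMultiplication-CartanCubic; deciding theorem
`closes : E6Flat → E6ThreeProducts → MatrixMultiplication`, proved in the route file).  The crux, with
`J` the route's inlined Cartan-cubic tensor on `Fin 3 × (Fin 3 × Fin 3)` (block, (row, col)), i.e. six
times the polarisation of `N(X,Y,Z) = det X + det Y + det Z − tr(XYZ)`: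

  `E6ThreeProducts : ∀ ε > 0, ∃ N k m, 1 ≤ N ∧ 3^{(1−ε)N} ≤ m ∧ 27^{(1−ε)N} ≤ k·m² ∧
      J^{⊠N} ⊵ ⊕_{i<k} ⟨m,m,m⟩`   (`PolyDegeneratesTo`, over `ℂ[λ]`)

("`J` is asymptotically three matrix products").

## The line: determinant removal + perfectness of the trace cubic

Write `J = D − T` cell-wise: on the three diagonal block cells `(X,X,X), (Y,Y,Y), (Z,Z,Z)` the tensor is
the polarised determinant `det₃ = ε₃ ⊠ ε₃`; on the six off-diagonal cells (block pattern = the six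
permutations of `(X,Y,Z)`, i.e. the affine line structure of `ℤ₃` minus its diagonal) it is `−1` times a
copy of the `3 × 3` matrix-multiplication pattern `tr(XYZ)`.  Let `J'` be **`J` with the three determinant
cells deleted** — verbatim the route term with the diagonal branch replaced by `0`; it is six times the
polarisation of the trace cubic `−tr(XYZ)` on `M₃ ⊕ M₃ ⊕ M₃`, a `GL₃³ ⋊ S₃`-symmetric, tight, free tensor
with uniform marginals (`6`), concise in the same format `27`.

* `stub_detRemoval` — **the E₆ side (open):** the determinant cells are ASYMPTOTICALLY REMOVABLE:
  for every `ε > 0` there are arbitrarily large levels `N` with `J^{⊠N} ⊵ J'^{⊠K}`, `K ≥ (1−ε)N`.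
  At every finite level `J ⋭ J'` torically (the three determinant cells cannot all be given larger
  toric weight than the six trace cells: both families average to one third of the total weight), so the
  Kronecker-power slack is essential — exactly as for the crux itself (model case impossible at `N = 1, 2`,
  route header).  Why plausibly true: every known point of the asymptotic spectrum takes the same value
  `27` on `J` and on `J'` (both tight and free with flat marginals, so all quantum functionals are `27`),
  and by Strassen's spectral theorem `J ≳ J'` iff `F(J) ≥ F(J')` for every spectral point `F`; it is
  implied by flatness of the trace cubic (`R̃(J') = 27`, an instance of the asymptotic rank conjecture)
  together with `Q̃(J) = 27` (Strassen 1991, tight tensors).  Why it might fail: a new spectral point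
  separating `J'` above `J`; or the determinant cells being load-bearing for matrix extraction.  Size XL.
* `stub_tracePerfect` — **the `GL₃³ ⋊ S₃` side (open):** the trace cubic is ASYMPTOTICALLY THREE MATRIX
  PRODUCTS: for every `ε > 0` and all large `K`, `J'^{⊠K} ⊵ k ⊙ ⟨3^K, 3^K, 3^K⟩` with `k ≥ 3^{(1−ε)K}`.
  Structure: `J' = −½ (u ⊠ P₊ + ε₃ ⊠ P₋)` with `u` the (unsigned) permutation tensor (`≅ cw₂`), `ε₃` the
  Levi-Civita tensor (`≅` skew-`cw₂`), `P₊`/`P₋` the Jordan resp. Lie bracket tensors of `M₃`; i.e. `J'` is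
  a `ℤ₂`-twist (sign of the block permutation acting by transposition of the inner pattern) of the
  untwisted `u ⊠ ⟨3,3,3⟩`, and the twist is NOT removable by block-diagonal isomorphisms (parity count:
  the three even cells force total parity `0`, the three odd cells force `1`).  Block-monomial extraction
  from `J'^{⊠K}` is capped by the tri-coloured sum-free capacity `2.7551^K` (same outer support as `J`), so
  the stub needs non-monomial, sign-untwisting degenerations.  Why plausibly true: implied by `ω = 2`
  together with `Q̃(J') = 27` (Strassen 1991: `J'` is tight and free with uniform marginals); conversely
  with `R̃(J') ≤ 27` it gives `ω = 2`.  Size XL (first way-points: the block-monomial optimum for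
  `J'^{⊠2}` — at least five disjoint `⟨9,9,9⟩` by the route's `E6SquareFiveProducts` certificate, which
  uses trace⊠trace cells only, at most `8` by criticality — and any extraction beating it).
* `threeProducts_of_transfer` — the sorry-free core, for ANY tensors `t, t'`: an asymptotic transfer
  `t^{⊠N} ⊵ t'^{⊠K}` (`K ≥ (1−ε)N`, `N` arbitrarily large) and eventual perfectness of `t'` in the model
  shape give the crux-shaped rate statement for `t` (transitivity of `PolyDegeneratesTo` + exponent
  bookkeeping `3^{(1−δ)K}·9^K ≥ 27^{(1−ε)N}`).
* `E6ThreeProducts_of` — THE skeleton theorem: the crux BY NAME from the two declared stubs (by name),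
  by the core and definitional unfolding of the route decl.  (The implication form
  `stub₁-statement → stub₂-statement → crux` is `threeProducts_of_transfer` itself at `t := J`,
  `t' := J'`: its conclusion is the crux unfolded, definitionally; sorry-free, standard axioms.  A
  crux-named implication form is not kept in the file because the skeleton audit admits only named
  obligations as hypotheses.)

Honest status.  Neither stub alone gives the crux or the summit (probes below); the two stubs isolate the
two twists by which `J` differs from the exactly-perfect untwisted model `ℂ[ℤ₃] ⊠ ⟨3,3,3⟩ ≅ 3 ⊙ ⟨3,3,3⟩`:
the determinant cells (E₆-specific, `stub_detRemoval`) and the sign-of-permutation twist of the trace part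
(`stub_tracePerfect`, a question about `pol(tr XYZ)` alone).  Rejected alternative: transferring to the
untwisted model `J₀ = ℂ[ℤ₃] ⊠ ⟨3,3,3⟩` directly — since `J₀^{⊠K} ≅ 3^K ⊙ ⟨3^K,3^K,3^K⟩`, that transfer IS
the crux's model case (costume).  Disproof used: none exists for this crux (`ledger crux ls
stmt-MatrixMultiplication-8157`: no workfiles, no `Negative/` lemma; `ledger negatives`: nothing on the E₆
cubic), so no `_false_without_` obligation applies.

BC3 probes (planner-run, `lean check`, each `first | exact? | simpa | simpa [X] | (unfold X; simpa) | aesop`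
under `maxHeartbeats 400000`, `X` the target): `stub_detRemoval → E6ThreeProducts`,
`stub_detRemoval → MatrixMultiplication`, `stub_tracePerfect → E6ThreeProducts`,
`stub_tracePerfect → MatrixMultiplication` — all must FAIL (files `bc/probe_*.lean` in the planner folder;
verdicts quoted in `Lines/birth.md`).
-/

-- `Summit.<Summit>.<Problem>`: for the single-conjunct summit the duplicate component is mandated.
set_option linter.dupNamespace false

noncomputable section

namespace Summit.MatrixMultiplication.MatrixMultiplication.Cruxes.E6ThreeProducts.Birth

open Literature.Computability.AlgebraicComplexity
open Literature.Barriers.MatrixMultiplication (PolyDegeneratesTo)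
open Summit.MatrixMultiplication.MatrixMultiplication.Theses.CartanCubic (E6ThreeProducts)

/-! ## The two registered stubs -/

/-- **Stub 1 — determinant removal (the E₆ side).**  The Cartan cubic tensor `J` (the route's term,
inlined) asymptotically degenerates onto its trace part `J'` (the same term with the three diagonal
determinant cells replaced by `0`, i.e. six times the polarisation of `−tr(XYZ)`): for every `ε > 0` and
every `N₀` there are `N ≥ N₀` and `K ≥ (1−ε)N` with `J^{⊠N} ⊵ J'^{⊠K}` over `ℂ[λ]`.  Impossible torically
at any finite level without slack; plausibly true because all known spectral points agree on `J` and `J'`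
(`= 27`) and it follows from flatness of the trace cubic plus `Q̃(J) = 27`.  Size XL, open.
Sources: Strassen1991, Strassen1988, ChristandlVranaZuiddam2023, Manivel2006, DuffFerrara2007,
ConnerGesmundoLandsbergVentura2022. -/
theorem stub_detRemoval :
    ∀ ε : ℝ, 0 < ε → ∀ N₀ : ℕ, ∃ N K : ℕ, N₀ ≤ N ∧ (1 - ε) * N ≤ K ∧
      Literature.Barriers.MatrixMultiplication.PolyDegeneratesTo
        (Literature.Computability.AlgebraicComplexity.kroneckerPow
          (fun a b c : Fin 3 × (Fin 3 × Fin 3) =>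
            (if a.1 = b.1 ∧ b.1 = c.1 then
                ((if b.2.1 = a.2.1 + 1 ∧ c.2.1 = a.2.1 + 2 then (1 : ℂ) else 0) -
                    (if b.2.1 = a.2.1 + 2 ∧ c.2.1 = a.2.1 + 1 then 1 else 0)) *
                  ((if b.2.2 = a.2.2 + 1 ∧ c.2.2 = a.2.2 + 2 then (1 : ℂ) else 0) -
                    (if b.2.2 = a.2.2 + 2 ∧ c.2.2 = a.2.2 + 1 then 1 else 0))
              else if b.1 = a.1 + 1 ∧ c.1 = a.1 + 2 then
                (if a.2.2 = b.2.1 ∧ b.2.2 = c.2.1 ∧ c.2.2 = a.2.1 then -1 else 0)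
              else if b.1 = a.1 + 2 ∧ c.1 = a.1 + 1 then
                (if a.2.2 = c.2.1 ∧ c.2.2 = b.2.1 ∧ b.2.2 = a.2.1 then -1 else 0)
              else 0 : ℂ))
          N)
        (Literature.Computability.AlgebraicComplexity.kroneckerPow
          (fun a b c : Fin 3 × (Fin 3 × Fin 3) =>
            (if a.1 = b.1 ∧ b.1 = c.1 then (0 : ℂ)
              else if b.1 = a.1 + 1 ∧ c.1 = a.1 + 2 then
                (if a.2.2 = b.2.1 ∧ b.2.2 = c.2.1 ∧ c.2.2 = a.2.1 then -1 else 0)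
              else if b.1 = a.1 + 2 ∧ c.1 = a.1 + 1 then
                (if a.2.2 = c.2.1 ∧ c.2.2 = b.2.1 ∧ b.2.2 = a.2.1 then -1 else 0)
              else 0 : ℂ))
          K) := by
  sorry

/-- **Stub 2 — the trace cubic is asymptotically three matrix products (the `GL₃³ ⋊ S₃` side).**  For the
trace part `J'` alone (six times the polarisation of `−tr(XYZ)`; a `ℤ₂`-twist of `ℂ[ℤ₃∖diag] ⊠ ⟨3,3,3⟩` by
the sign of the block permutation, not removable block-diagonally): for every `ε > 0` and all large `K`,
`J'^{⊠K} ⊵ k ⊙ ⟨3^K, 3^K, 3^K⟩` with `k ≥ 3^{(1−ε)K}` (the perfect rate in the model shape).  Block-monomial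
extraction is capped at `2.7551^K` (tri-coloured sum-free capacity), so this needs sign-untwisting,
non-monomial degenerations; plausibly true because it is implied by `ω = 2` together with `Q̃(J') = 27`
(Strassen 1991: `J'` is tight and free with uniform marginals).  Size XL, open.
Sources: Strassen1991, CoppersmithWinograd1990, KleinbergSawinSpeyer2018,
BlasiakChurchCohnGrochowNaslundSawinUmans2017, ChristandlVranaZuiddam2023, Blaser2013. -/
theorem stub_tracePerfect :
    ∀ ε : ℝ, 0 < ε → ∃ K₀ : ℕ, ∀ K : ℕ, K₀ ≤ K → ∃ k : ℕ, (3 : ℝ) ^ ((1 - ε) * K) ≤ k ∧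
      Literature.Barriers.MatrixMultiplication.PolyDegeneratesTo
        (Literature.Computability.AlgebraicComplexity.kroneckerPow
          (fun a b c : Fin 3 × (Fin 3 × Fin 3) =>
            (if a.1 = b.1 ∧ b.1 = c.1 then (0 : ℂ)
              else if b.1 = a.1 + 1 ∧ c.1 = a.1 + 2 then
                (if a.2.2 = b.2.1 ∧ b.2.2 = c.2.1 ∧ c.2.2 = a.2.1 then -1 else 0)
              else if b.1 = a.1 + 2 ∧ c.1 = a.1 + 1 then
                (if a.2.2 = c.2.1 ∧ c.2.2 = b.2.1 ∧ b.2.2 = a.2.1 then -1 else 0)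
              else 0 : ℂ))
          K)
        (Literature.Computability.AlgebraicComplexity.matMulDirectSum ℂ
          (fun _ : Fin k => 3 ^ K) (fun _ => 3 ^ K) (fun _ => 3 ^ K)) := by
  sorry

/-! ## Sorry-free core -/

/-- **Transfer + perfectness ⇒ the crux-shaped rate**, for ANY tensors `t` (source) and `t'` (model):
if `t^{⊠N} ⊵ t'^{⊠K}` with `K ≥ (1−ε)N` at arbitrarily large levels `N` (every `ε > 0`), and for every
`ε > 0` eventually (in `K`) `t'^{⊠K} ⊵ k ⊙ ⟨3^K,3^K,3^K⟩` with `k ≥ 3^{(1−ε)K}`, then for every `ε > 0`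
some `t^{⊠N}` (`N ≥ 1`) degenerates to `k` disjoint `⟨m,m,m⟩` with `m ≥ 3^{(1−ε)N}` and
`k m² ≥ 27^{(1−ε)N}`.  Proof: shrink `ε` to `δ = min(ε, 1/2)/4`, compose the two degenerations
(`PolyDegeneratesTo.trans`) at a level `N ≥ 2K₀ + 1`, take `m = 3^K`, and compare exponents:
`(1−ε)N ≤ (1−δ)N ≤ K` and `3(1−ε)N ≤ (3−δ)(1−δ)N ≤ (1−δ)K + 2K`. [folklore] -/
theorem threeProducts_of_transfer {ι ι' : Type*} [Fintype ι] [DecidableEq ι] [Fintype ι']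
    [DecidableEq ι'] {t : ι → ι → ι → ℂ} {t' : ι' → ι' → ι' → ℂ}
    (hA : ∀ ε : ℝ, 0 < ε → ∀ N₀ : ℕ, ∃ N K : ℕ, N₀ ≤ N ∧ (1 - ε) * N ≤ K ∧
      PolyDegeneratesTo (kroneckerPow t N) (kroneckerPow t' K))
    (hB : ∀ ε : ℝ, 0 < ε → ∃ K₀ : ℕ, ∀ K : ℕ, K₀ ≤ K → ∃ k : ℕ, (3 : ℝ) ^ ((1 - ε) * K) ≤ k ∧
      PolyDegeneratesTo (kroneckerPow t' K)
        (matMulDirectSum ℂ (fun _ : Fin k => 3 ^ K) (fun _ => 3 ^ K) (fun _ => 3 ^ K))) :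
    ∀ ε : ℝ, 0 < ε → ∃ N k m : ℕ, 1 ≤ N ∧ (3 : ℝ) ^ ((1 - ε) * N) ≤ m ∧
      (27 : ℝ) ^ ((1 - ε) * N) ≤ (k : ℝ) * (m : ℝ) ^ 2 ∧
      PolyDegeneratesTo (kroneckerPow t N)
        (matMulDirectSum ℂ (fun _ : Fin k => m) (fun _ => m) (fun _ => m)) := by
  intro ε hε
  -- shrink `ε`
  set δ : ℝ := min ε (1 / 2) / 4 with hδ
  have hmin0 : 0 < min ε (1 / 2) := lt_min hε (by norm_num)
  have hδ0 : 0 < δ := by rw [hδ]; positivity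
  have hδε : 4 * δ ≤ ε := by
    rw [hδ]; have := min_le_left ε (1 / 2); linarith
  have hδhalf : 4 * δ ≤ 1 / 2 := by
    rw [hδ]; have := min_le_right ε (1 / 2); linarith
  -- the two degenerations, at compatible levels
  obtain ⟨K₀, hK₀⟩ := hB δ hδ0
  obtain ⟨N, K, hN, hKN, hdegA⟩ := hA δ hδ0 (2 * K₀ + 1)
  have hN1 : 1 ≤ N := by omega
  have hNr : (2 * K₀ + 1 : ℝ) ≤ N := by exact_mod_cast hN
  have hN0 : (0 : ℝ) ≤ N := by positivity
  have hKr : (K₀ : ℝ) ≤ K := by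
    have h1 : (1 - δ) * (N : ℝ) ≥ (1 / 2) * N := by
      apply mul_le_mul_of_nonneg_right _ hN0; linarith
    linarith
  have hK : K₀ ≤ K := by exact_mod_cast hKr
  obtain ⟨k, hk, hdegB⟩ := hK₀ K hK
  refine ⟨N, k, 3 ^ K, hN1, ?_, ?_, hdegA.trans hdegB⟩
  · -- `3^{(1-ε)N} ≤ 3^K = m`
    have h1 : (1 - ε) * (N : ℝ) ≤ (K : ℝ) := by
      have h2 : (1 - ε) * (N : ℝ) ≤ (1 - δ) * N := by
        apply mul_le_mul_of_nonneg_right _ hN0; linarith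
      exact h2.trans hKN
    calc (3 : ℝ) ^ ((1 - ε) * N) ≤ (3 : ℝ) ^ (K : ℝ) :=
          Real.rpow_le_rpow_of_exponent_le (by norm_num) h1
      _ = ((3 ^ K : ℕ) : ℝ) := by rw [Real.rpow_natCast]; push_cast; ring
  · -- `27^{(1-ε)N} = 3^{3(1-ε)N} ≤ 3^{(1-δ)K + 2K} = 3^{(1-δ)K} · 9^K ≤ k · m²`
    have hexp : 3 * ((1 - ε) * (N : ℝ)) ≤ (1 - δ) * K + ((2 * K : ℕ) : ℝ) := by
      push_cast
      have h3 : (3 - δ) * ((1 - δ) * (N : ℝ)) ≤ (3 - δ) * K :=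
        mul_le_mul_of_nonneg_left hKN (by linarith)
      have h4 : 3 * ((1 - ε) * (N : ℝ)) ≤ (3 - δ) * ((1 - δ) * N) := by
        have h5 : 0 ≤ (3 * ε - 4 * δ + δ ^ 2) * (N : ℝ) :=
          mul_nonneg (by nlinarith) hN0
        nlinarith
      linarith
    have h27 : (3 : ℝ) ^ (3 : ℝ) = 27 := by
      have : (3 : ℝ) ^ ((3 : ℕ) : ℝ) = 27 := by rw [Real.rpow_natCast]; norm_num
      exact_mod_cast this
    calc (27 : ℝ) ^ ((1 - ε) * N) = (3 : ℝ) ^ (3 * ((1 - ε) * N)) := by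
          rw [Real.rpow_mul (by norm_num : (0 : ℝ) ≤ 3), h27]
      _ ≤ (3 : ℝ) ^ ((1 - δ) * K + ((2 * K : ℕ) : ℝ)) :=
          Real.rpow_le_rpow_of_exponent_le (by norm_num) hexp
      _ = (3 : ℝ) ^ ((1 - δ) * K) * (3 : ℝ) ^ (((2 * K : ℕ)) : ℝ) :=
          Real.rpow_add (by norm_num) _ _
      _ = (3 : ℝ) ^ ((1 - δ) * K) * (((3 ^ K : ℕ) : ℝ)) ^ 2 := by
          rw [Real.rpow_natCast]; push_cast; ring
      _ ≤ (k : ℝ) * (((3 ^ K : ℕ) : ℝ)) ^ 2 :=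
          mul_le_mul_of_nonneg_right hk (by positivity)

/-! ## The composition: the two stubs prove the crux BY NAME -/

/-- **THE SKELETON THEOREM.** The crux
`Summit.MatrixMultiplication.MatrixMultiplication.Theses.CartanCubic.E6ThreeProducts`
(stmt-MatrixMultiplication-8157), concluded BY NAME from the two DECLARED stubs `stub_detRemoval`
(determinant removal, `J ≳ J'`) and `stub_tracePerfect` (the trace cubic is asymptotically three matrix
products) — the only `sorry`s of the file — through the sorry-free core `threeProducts_of_transfer` and
definitional unfolding of the route decl (its `let J := …` is the first inlined tensor). [folklore] -/
theorem E6ThreeProducts_of :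
    Summit.MatrixMultiplication.MatrixMultiplication.Theses.CartanCubic.E6ThreeProducts :=
  threeProducts_of_transfer stub_detRemoval stub_tracePerfect

end Summit.MatrixMultiplication.MatrixMultiplication.Cruxes.E6ThreeProducts.Birth

end
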